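import Literature.MathematicalPhysics.KineticTheory.InfiniteChainGibbsPositionByParts
import Literature.MathematicalPhysics.KineticTheory.InfiniteChainGibbsNormalisable
import Literature.MathematicalPhysics.KineticTheory.InfiniteChainAmplitudeScaling
import HarnessLib

/-!
# The one-site integration-by-parts (Schwinger–Dyson) identities for the bond force of the pinned anharmonic chain

Topic `Literature/MathematicalPhysics/KineticTheory` (companion of `InfiniteChainGibbsPositionByParts`). For
`pinnedChain ω₂ lam β γ` (`U(q) = ω₂q²/2 + lam q⁴/4`, `V(r) = r²/2 + βr⁴/4`; `ω₂ > 0`, `lam, β ≥ 0`) and a DLR state `μ` at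
`T > 0` (`IsChainGibbsMeasure`):

* §1 the one-site weight `h_η(q) = U(q) + V(b − q) + V(q − a)` is `≥ ω₂q²/2`, so `e^{-h_η/T} ≤ e^{-ω₂q²/(2T)}`; its derivative;
  the test functions `V'(q − a)`, `V'(b − q)` and their derivatives;
* §2 `T ∫ V''(q₁ − q₀) dμ = ∫ V'(q₁ − q₀)·(U'(q₁) + V'(q₁ − q₀) − V'(q₂ − q₁)) dμ` (site `1`) and
  `−T ∫ V''(q₁ − q₀) dμ = ∫ V'(q₁ − q₀)·(U'(q₀) + V'(q₀ − q₋₁) − V'(q₁ − q₀)) dμ` (site `0`), for every DLR state under which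
  both sides are integrable: the one-site identity holds boundary condition by boundary condition (polynomial observables
  against a Gaussian-dominated weight) and the DLR equation lifts it.

Classical equipartition / "virial" identities of equilibrium statistical mechanics, in infinite volume through the DLR
equations (Georgii 2011, Rem. 1.24). Everything is proved; tagged `[folklore]`. No definitions, no named facts. NOT here:
finiteness of the moments (needs a specific state: superstability of the shift-invariant DLR state, see the consumer
`Summits/…/Theorems/EmbeddedDrudeMourreDrudeDissolutionStubBondForceIdentity.lean`).
-/

noncomputable section

open MeasureTheory ProbabilityTheory Filter Set Real Literature.Probability.LatticeModels
open scoped ENNReal Topology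

namespace Literature.MathematicalPhysics.KineticTheory.HeatConduction

open OscillatorChain

/-! ## §1 The pinned chain: one-site weight, test functions -/

section PinnedChain

variable {ω₂ lam β γ : ℝ}

/-- `U` of `pinnedChain` is continuous. [folklore] -/
theorem continuous_pinnedChain_U (ω₂ lam β γ : ℝ) : Continuous (pinnedChain ω₂ lam β γ).U := by
  show Continuous fun q : ℝ => ω₂ * q ^ 2 / 2 + lam * q ^ 4 / 4
  fun_prop

/-- `V` of `pinnedChain` is continuous. [folklore] -/
theorem continuous_pinnedChain_V (ω₂ lam β γ : ℝ) : Continuous (pinnedChain ω₂ lam β γ).V := by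
  show Continuous fun r : ℝ => r ^ 2 / 2 + β * r ^ 4 / 4
  fun_prop

/-- The one-site position weight of `pinnedChain` with neighbours `a` (left) and `b` (right),
`W(q) = U(q) + V(b − q) + V(q − a)`, is bounded below by the harmonic pinning: `ω₂ q²/2 ≤ W(q)` (`lam, β ≥ 0`).
[folklore] -/
theorem pinnedChain_siteWeight_ge (hl : 0 ≤ lam) (hβ : 0 ≤ β) (a b q : ℝ) :
    ω₂ * q ^ 2 / 2 ≤ (pinnedChain ω₂ lam β γ).U q +
      ((pinnedChain ω₂ lam β γ).V (b - q) + (pinnedChain ω₂ lam β γ).V (q - a)) := by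
  show ω₂ * q ^ 2 / 2 ≤ ω₂ * q ^ 2 / 2 + lam * q ^ 4 / 4 +
    ((b - q) ^ 2 / 2 + β * (b - q) ^ 4 / 4 + ((q - a) ^ 2 / 2 + β * (q - a) ^ 4 / 4))
  have : 0 ≤ lam * q ^ 4 / 4 + ((b - q) ^ 2 / 2 + β * (b - q) ^ 4 / 4 +
      ((q - a) ^ 2 / 2 + β * (q - a) ^ 4 / 4)) := by positivity
  linarith

/-- Hence the one-site Boltzmann weight is dominated by a Gaussian: `e^{-W(q)/T} ≤ e^{-(ω₂/(2T)) q²}` (`T > 0`).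
[folklore] -/
theorem pinnedChain_exp_neg_siteWeight_le (hl : 0 ≤ lam) (hβ : 0 ≤ β) {T : ℝ} (hT : 0 < T)
    (a b q : ℝ) :
    exp (-((pinnedChain ω₂ lam β γ).U q +
        ((pinnedChain ω₂ lam β γ).V (b - q) + (pinnedChain ω₂ lam β γ).V (q - a))) / T) ≤
      exp (-(ω₂ / (2 * T) * q ^ 2)) := by
  refine exp_le_exp.2 ?_
  have h := pinnedChain_siteWeight_ge (ω₂ := ω₂) (γ := γ) hl hβ a b q
  rw [neg_div, neg_le_neg_iff, le_div_iff₀ hT]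
  have : ω₂ / (2 * T) * q ^ 2 * T = ω₂ * q ^ 2 / 2 := by field_simp
  linarith

/-- The derivative of the one-site weight: `W'(q) = U'(q) − V'(b − q) + V'(q − a)` with `U'(q) = ω₂q + lam q³`,
`V'(r) = r + βr³`. [folklore] -/
theorem pinnedChain_hasDerivAt_siteWeight (a b q : ℝ) :
    HasDerivAt (fun q => (pinnedChain ω₂ lam β γ).U q +
        ((pinnedChain ω₂ lam β γ).V (b - q) + (pinnedChain ω₂ lam β γ).V (q - a)))
      ((ω₂ * q + lam * q ^ 3) - ((b - q) + β * (b - q) ^ 3) + ((q - a) + β * (q - a) ^ 3)) q := by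
  have hU := AmplitudeScaling.hasDerivAt_U ω₂ lam β γ q
  have hVb : HasDerivAt (fun q => (pinnedChain ω₂ lam β γ).V (b - q))
      (((b - q) + β * (b - q) ^ 3) * (-1)) q := by
    have h1 : HasDerivAt (fun q : ℝ => b - q) (-1) q := by
      simpa using (hasDerivAt_id q).const_sub b
    exact (AmplitudeScaling.hasDerivAt_V ω₂ lam β γ (b - q)).comp q h1
  have hVa : HasDerivAt (fun q => (pinnedChain ω₂ lam β γ).V (q - a))
      (((q - a) + β * (q - a) ^ 3) * 1) q := by
    have h1 : HasDerivAt (fun q : ℝ => q - a) 1 q := by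
      simpa using (hasDerivAt_id q).sub_const a
    exact (AmplitudeScaling.hasDerivAt_V ω₂ lam β γ (q - a)).comp q h1
  refine (hU.add (hVb.add hVa)).congr_deriv ?_
  ring

/-- The test function `G(q) = V'(q − a)` has derivative `1 + 3β(q − a)²`. [folklore] -/
theorem hasDerivAt_bondForce (β a q : ℝ) :
    HasDerivAt (fun q => (q - a) + β * (q - a) ^ 3) (1 + 3 * β * (q - a) ^ 2) q := by
  have h1 : HasDerivAt (fun q : ℝ => q - a) 1 q := by simpa using (hasDerivAt_id q).sub_const a
  refine (h1.add ((h1.pow 3).const_mul β)).congr_deriv ?_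
  simp only [Nat.cast_ofNat]
  ring

/-- The test function `G(q) = V'(b − q)` (the same bond force seen from its left end) has derivative
`−(1 + 3β(b − q)²)`. [folklore] -/
theorem hasDerivAt_bondForce' (β b q : ℝ) :
    HasDerivAt (fun q => (b - q) + β * (b - q) ^ 3) (-(1 + 3 * β * (b - q) ^ 2)) q := by
  have h1 : HasDerivAt (fun q : ℝ => b - q) (-1) q := by simpa using (hasDerivAt_id q).const_sub b
  refine (h1.add ((h1.pow 3).const_mul β)).congr_deriv ?_
  simp only [Nat.cast_ofNat]
  ring

/-! ## §2 The conditional identities and their DLR lift -/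

/-- **One-site integration by parts at site `1` for `g = V'(q₁ − q₀)` under a DLR state of the pinned chain**:
`T ∫ V''(q₁ − q₀) dμ = ∫ V'(q₁ − q₀)·(U'(q₁) + V'(q₁ − q₀) − V'(q₂ − q₁)) dμ`, for every DLR state `μ` at `T > 0`
under which both integrands are integrable (`ω₂ > 0`, `lam, β ≥ 0`). [folklore] -/
theorem pinnedChain_integral_byParts_site_one (hω : 0 < ω₂) (hl : 0 ≤ lam) (hβ : 0 ≤ β) {T : ℝ}
    (hT : 0 < T) {μ : Measure ChainConfig} (hμ : (pinnedChain ω₂ lam β γ).IsChainGibbsMeasure T μ)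
    (hI₁ : Integrable (fun σ : ChainConfig => T * (1 + 3 * β * ((σ 1).1 - (σ 0).1) ^ 2)) μ)
    (hI₂ : Integrable (fun σ : ChainConfig =>
      (((σ 1).1 - (σ 0).1) + β * ((σ 1).1 - (σ 0).1) ^ 3) *
        ((ω₂ * (σ 1).1 + lam * (σ 1).1 ^ 3) + (((σ 1).1 - (σ 0).1) + β * ((σ 1).1 - (σ 0).1) ^ 3) -
          (((σ 2).1 - (σ 1).1) + β * ((σ 2).1 - (σ 1).1) ^ 3))) μ) :
    T * ∫ σ : ChainConfig, (1 + 3 * β * ((σ 1).1 - (σ 0).1) ^ 2) ∂μ =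
      ∫ σ : ChainConfig, (((σ 1).1 - (σ 0).1) + β * ((σ 1).1 - (σ 0).1) ^ 3) *
        ((ω₂ * (σ 1).1 + lam * (σ 1).1 ^ 3) + (((σ 1).1 - (σ 0).1) + β * ((σ 1).1 - (σ 0).1) ^ 3) -
          (((σ 2).1 - (σ 1).1) + β * ((σ 2).1 - (σ 1).1) ^ 3)) ∂μ := by
  have hU := continuous_pinnedChain_U ω₂ lam β γ
  have hV := continuous_pinnedChain_V ω₂ lam β γ
  have hB2 : (pinnedChain ω₂ lam β γ).CondB2 T := condB2_pinnedChain γ hω hl hβ hT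
  have hq : ∀ x : ℤ, Measurable fun σ : ChainConfig => (σ x).1 := fun x => (measurable_pi_apply x).fst
  -- the two observables
  set Φ₁ : ChainConfig → ℝ := fun σ => T * (1 + 3 * β * ((σ 1).1 - (σ 0).1) ^ 2) with hΦ₁
  set Φ₂ : ChainConfig → ℝ := fun σ => (((σ 1).1 - (σ 0).1) + β * ((σ 1).1 - (σ 0).1) ^ 3) *
      ((ω₂ * (σ 1).1 + lam * (σ 1).1 ^ 3) + (((σ 1).1 - (σ 0).1) + β * ((σ 1).1 - (σ 0).1) ^ 3) -
        (((σ 2).1 - (σ 1).1) + β * ((σ 2).1 - (σ 1).1) ^ 3)) with hΦ₂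
  have hΦ₁m : Measurable Φ₁ :=
    measurable_const.mul (measurable_const.add (measurable_const.mul (((hq 1).sub (hq 0)).pow_const 2)))
  have hA : Measurable fun σ : ChainConfig => ((σ 1).1 - (σ 0).1) + β * ((σ 1).1 - (σ 0).1) ^ 3 :=
    ((hq 1).sub (hq 0)).add (measurable_const.mul (((hq 1).sub (hq 0)).pow_const 3))
  have hB : Measurable fun σ : ChainConfig => ((σ 2).1 - (σ 1).1) + β * ((σ 2).1 - (σ 1).1) ^ 3 :=
    ((hq 2).sub (hq 1)).add (measurable_const.mul (((hq 2).sub (hq 1)).pow_const 3))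
  have hUp : Measurable fun σ : ChainConfig => ω₂ * (σ 1).1 + lam * (σ 1).1 ^ 3 :=
    (measurable_const.mul (hq 1)).add (measurable_const.mul ((hq 1).pow_const 3))
  have hΦ₂m : Measurable Φ₂ := hA.mul ((hUp.add hA).sub hB)
  -- the conditional identity, boundary condition by boundary condition
  have hcond : ∀ η : ChainConfig, ∫ σ, Φ₁ σ ∂((pinnedChain ω₂ lam β γ).chainSpecification T {1} η) =
      ∫ σ, Φ₂ σ ∂((pinnedChain ω₂ lam β γ).chainSpecification T {1} η) := by
    intro η
    set a : ℝ := (η 0).1 with ha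
    set b : ℝ := (η 2).1 with hb
    have h10 : (0:ℤ) ≠ 1 := by norm_num
    have h12 : (2:ℤ) ≠ 1 := by norm_num
    -- the observables along the inserted site
    set G : ℝ → ℝ := fun q => (q - a) + β * (q - a) ^ 3 with hG
    set G' : ℝ → ℝ := fun q => 1 + 3 * β * (q - a) ^ 2 with hG'
    set W : ℝ → ℝ := fun q => (pinnedChain ω₂ lam β γ).U q +
      ((pinnedChain ω₂ lam β γ).V (b - q) + (pinnedChain ω₂ lam β γ).V (q - a)) with hW
    set W' : ℝ → ℝ := fun q => (ω₂ * q + lam * q ^ 3) - ((b - q) + β * (b - q) ^ 3) +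
      ((q - a) + β * (q - a) ^ 3) with hW'
    have e₁ : ∀ z : ℝ × ℝ, Φ₁ (siteInsert 1 η z) = T * G' z.1 := by
      intro z
      simp only [hΦ₁, hG', siteInsert_apply_self, siteInsert_apply_of_ne h10, ha]
    have e₂ : ∀ z : ℝ × ℝ, Φ₂ (siteInsert 1 η z) = G z.1 * W' z.1 := by
      intro z
      simp only [hΦ₂, hG, hW', siteInsert_apply_self, siteInsert_apply_of_ne h10,
        siteInsert_apply_of_ne h12, ha, hb]
      ring
    have hWq : ∀ q, (pinnedChain ω₂ lam β γ).U q + ((pinnedChain ω₂ lam β γ).V ((η (1 + 1)).1 - q) +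
        (pinnedChain ω₂ lam β γ).V (q - (η (1 - 1)).1)) = W q := by
      intro q; simp only [hW, hb, ha]; norm_num
    rw [integral_chainSpecification_singleton_position (φ := fun q => T * G' q) hU hV hT 1 η hΦ₁m e₁,
      integral_chainSpecification_singleton_position (φ := fun q => G q * W' q) hU hV hT 1 η hΦ₂m e₂]
    simp_rw [hWq]
    congr 1
    -- `∫ T G' e^{-W/T} = ∫ G W' e^{-W/T}` on the line
    have hw0 : ∀ q, 0 ≤ exp (-(W q) / T) := fun q => (exp_pos _).le
    have hwb : ∀ q, exp (-(W q) / T) ≤ exp (-(ω₂ / (2 * T) * q ^ 2)) := fun q =>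
      pinnedChain_exp_neg_siteWeight_le (ω₂ := ω₂) (γ := γ) hl hβ hT a b q
    have hwc : Continuous fun q => exp (-(W q) / T) := by
      have : Continuous W := by simp only [hW]; fun_prop
      fun_prop
    have ha' : 0 < ω₂ / (2 * T) := by positivity
    set c : ℝ := 1 + |a| + |b| with hc
    have hc0 : 0 ≤ c := by positivity
    have hbounds := fun q => abs_shift_le a b q
    have hGb : ∀ q, |G q| ≤ (c + β * c ^ 3) * (1 + |q|) ^ 3 := fun q =>
      abs_add_mul_cube_le hβ hc0 (hbounds q).1 (by linarith [abs_nonneg q])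
    have hG'b : ∀ q, |G' q| ≤ (1 + 3 * β * c ^ 2) * (1 + |q|) ^ 2 := fun q =>
      abs_one_add_mul_sq_le hβ (hbounds q).1 (by linarith [abs_nonneg q])
    have hW'b : ∀ q, |W' q| ≤ ((ω₂ * c + lam * c ^ 3) + (c + β * c ^ 3) + (c + β * c ^ 3)) *
        (1 + |q|) ^ 3 := by
      intro q
      have ht : 1 ≤ 1 + |q| := by linarith [abs_nonneg q]
      have h1 := abs_lin_add_cube_le hω.le hl hc0 (hbounds q).2.2 ht
      have h2 := abs_add_mul_cube_le hβ hc0 (hbounds q).2.1 ht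
      have h3 := hGb q
      calc |W' q| ≤ |ω₂ * q + lam * q ^ 3 - ((b - q) + β * (b - q) ^ 3)| + |(q - a) + β * (q - a) ^ 3| :=
            abs_add_le _ _
        _ ≤ (|ω₂ * q + lam * q ^ 3| + |(b - q) + β * (b - q) ^ 3|) + |(q - a) + β * (q - a) ^ 3| := by
            gcongr; exact abs_sub _ _
        _ ≤ _ := by rw [hG] at h3; linarith
    have hGW'b : ∀ q, |G q * W' q| ≤ ((c + β * c ^ 3) *
        ((ω₂ * c + lam * c ^ 3) + (c + β * c ^ 3) + (c + β * c ^ 3))) * (1 + |q|) ^ 6 := by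
      intro q
      rw [abs_mul]
      have h1 := hGb q; have h2 := hW'b q
      have h0 : 0 ≤ (1 + |q|) ^ 3 := by positivity
      calc |G q| * |W' q| ≤ ((c + β * c ^ 3) * (1 + |q|) ^ 3) *
            (((ω₂ * c + lam * c ^ 3) + (c + β * c ^ 3) + (c + β * c ^ 3)) * (1 + |q|) ^ 3) :=
            mul_le_mul h1 h2 (abs_nonneg _) (by positivity)
        _ = _ := by ring
    have hGc : Continuous G := by simp only [hG]; fun_prop
    have hG'c : Continuous G' := by simp only [hG']; fun_prop
    have hW'c : Continuous W' := by simp only [hW']; fun_prop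
    have hi₀ : Integrable fun q => G q * exp (-(W q) / T) :=
      integrable_mul_of_abs_le_pow_of_le_gauss hGc hwc ha' hGb hw0 hwb
    have hi₁ : Integrable fun q => G' q * exp (-(W q) / T) :=
      integrable_mul_of_abs_le_pow_of_le_gauss hG'c hwc ha' hG'b hw0 hwb
    have hi₂ : Integrable fun q => G q * W' q * exp (-(W q) / T) :=
      integrable_mul_of_abs_le_pow_of_le_gauss (hGc.mul hW'c) hwc ha' hGW'b hw0 hwb
    have hGd : ∀ q, HasDerivAt G (G' q) q := fun q => hasDerivAt_bondForce β a q
    have hWd : ∀ q, HasDerivAt W (W' q) q := fun q =>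
      pinnedChain_hasDerivAt_siteWeight (ω₂ := ω₂) (lam := lam) (β := β) (γ := γ) a b q
    have key := integral_deriv_mul_exp_eq hT.ne' hGd hWd hi₀ hi₁ hi₂
    calc ∫ q, T * G' q * exp (-(W q) / T) = T * ∫ q, G' q * exp (-(W q) / T) := by
          rw [← integral_const_mul]; refine integral_congr_ae (Eventually.of_forall fun q => ?_); ring
      _ = ∫ q, G q * W' q * exp (-(W q) / T) := key
  -- DLR lift
  have h1 := integral_eq_integral_integral_chainSpecification hU.measurable hV.measurable hB2 hμ {1} hI₁
  have h2 := integral_eq_integral_integral_chainSpecification hU.measurable hV.measurable hB2 hμ {1} hI₂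
  change ∫ σ, Φ₁ σ ∂μ = _ at h1
  change ∫ σ, Φ₂ σ ∂μ = _ at h2
  calc T * ∫ σ : ChainConfig, (1 + 3 * β * ((σ 1).1 - (σ 0).1) ^ 2) ∂μ = ∫ σ, Φ₁ σ ∂μ := by
        rw [← integral_const_mul]
    _ = ∫ η, ∫ σ, Φ₁ σ ∂((pinnedChain ω₂ lam β γ).chainSpecification T {1} η) ∂μ := h1
    _ = ∫ η, ∫ σ, Φ₂ σ ∂((pinnedChain ω₂ lam β γ).chainSpecification T {1} η) ∂μ := by simp_rw [hcond]
    _ = ∫ σ, Φ₂ σ ∂μ := h2.symm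

/-- **One-site integration by parts at site `0` for `g = V'(q₁ − q₀)` under a DLR state of the pinned chain**:
`−T ∫ V''(q₁ − q₀) dμ = ∫ V'(q₁ − q₀)·(U'(q₀) + V'(q₀ − q₋₁) − V'(q₁ − q₀)) dμ`, for every DLR state `μ` at `T > 0`
under which both integrands are integrable (`ω₂ > 0`, `lam, β ≥ 0`; the sign comes from `∂_{q₀}V'(q₁ − q₀) =
−V''(q₁ − q₀)`). [folklore] -/
theorem pinnedChain_integral_byParts_site_zero (hω : 0 < ω₂) (hl : 0 ≤ lam) (hβ : 0 ≤ β) {T : ℝ}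
    (hT : 0 < T) {μ : Measure ChainConfig} (hμ : (pinnedChain ω₂ lam β γ).IsChainGibbsMeasure T μ)
    (hI₁ : Integrable (fun σ : ChainConfig => T * (-(1 + 3 * β * ((σ 1).1 - (σ 0).1) ^ 2))) μ)
    (hI₂ : Integrable (fun σ : ChainConfig =>
      (((σ 1).1 - (σ 0).1) + β * ((σ 1).1 - (σ 0).1) ^ 3) *
        ((ω₂ * (σ 0).1 + lam * (σ 0).1 ^ 3) + (((σ 0).1 - (σ (-1)).1) + β * ((σ 0).1 - (σ (-1)).1) ^ 3) -
          (((σ 1).1 - (σ 0).1) + β * ((σ 1).1 - (σ 0).1) ^ 3))) μ) :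
    ∫ σ : ChainConfig, T * (-(1 + 3 * β * ((σ 1).1 - (σ 0).1) ^ 2)) ∂μ =
      ∫ σ : ChainConfig, (((σ 1).1 - (σ 0).1) + β * ((σ 1).1 - (σ 0).1) ^ 3) *
        ((ω₂ * (σ 0).1 + lam * (σ 0).1 ^ 3) + (((σ 0).1 - (σ (-1)).1) + β * ((σ 0).1 - (σ (-1)).1) ^ 3) -
          (((σ 1).1 - (σ 0).1) + β * ((σ 1).1 - (σ 0).1) ^ 3)) ∂μ := by
  have hU := continuous_pinnedChain_U ω₂ lam β γ
  have hV := continuous_pinnedChain_V ω₂ lam β γ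
  have hB2 : (pinnedChain ω₂ lam β γ).CondB2 T := condB2_pinnedChain γ hω hl hβ hT
  have hq : ∀ x : ℤ, Measurable fun σ : ChainConfig => (σ x).1 := fun x => (measurable_pi_apply x).fst
  -- the two observables
  set Φ₁ : ChainConfig → ℝ := fun σ => T * (-(1 + 3 * β * ((σ 1).1 - (σ 0).1) ^ 2)) with hΦ₁
  set Φ₂ : ChainConfig → ℝ := fun σ => (((σ 1).1 - (σ 0).1) + β * ((σ 1).1 - (σ 0).1) ^ 3) *
      ((ω₂ * (σ 0).1 + lam * (σ 0).1 ^ 3) + (((σ 0).1 - (σ (-1)).1) + β * ((σ 0).1 - (σ (-1)).1) ^ 3) -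
        (((σ 1).1 - (σ 0).1) + β * ((σ 1).1 - (σ 0).1) ^ 3)) with hΦ₂
  have hΦ₁m : Measurable Φ₁ :=
    measurable_const.mul (measurable_const.add (measurable_const.mul (((hq 1).sub (hq 0)).pow_const 2))).neg
  have hA : Measurable fun σ : ChainConfig => ((σ 1).1 - (σ 0).1) + β * ((σ 1).1 - (σ 0).1) ^ 3 :=
    ((hq 1).sub (hq 0)).add (measurable_const.mul (((hq 1).sub (hq 0)).pow_const 3))
  have hC : Measurable fun σ : ChainConfig => ((σ 0).1 - (σ (-1)).1) + β * ((σ 0).1 - (σ (-1)).1) ^ 3 :=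
    ((hq 0).sub (hq (-1))).add (measurable_const.mul (((hq 0).sub (hq (-1))).pow_const 3))
  have hUp : Measurable fun σ : ChainConfig => ω₂ * (σ 0).1 + lam * (σ 0).1 ^ 3 :=
    (measurable_const.mul (hq 0)).add (measurable_const.mul ((hq 0).pow_const 3))
  have hΦ₂m : Measurable Φ₂ := hA.mul ((hUp.add hC).sub hA)
  -- the conditional identity, boundary condition by boundary condition
  have hcond : ∀ η : ChainConfig, ∫ σ, Φ₁ σ ∂((pinnedChain ω₂ lam β γ).chainSpecification T {0} η) =
      ∫ σ, Φ₂ σ ∂((pinnedChain ω₂ lam β γ).chainSpecification T {0} η) := by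
    intro η
    set a : ℝ := (η (-1)).1 with ha
    set b : ℝ := (η 1).1 with hb
    have h10 : (1:ℤ) ≠ 0 := by norm_num
    have h12 : (-1:ℤ) ≠ 0 := by norm_num
    -- the observables along the inserted site
    set G : ℝ → ℝ := fun q => (b - q) + β * (b - q) ^ 3 with hG
    set G' : ℝ → ℝ := fun q => -(1 + 3 * β * (b - q) ^ 2) with hG'
    set W : ℝ → ℝ := fun q => (pinnedChain ω₂ lam β γ).U q +
      ((pinnedChain ω₂ lam β γ).V (b - q) + (pinnedChain ω₂ lam β γ).V (q - a)) with hW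
    set W' : ℝ → ℝ := fun q => (ω₂ * q + lam * q ^ 3) - ((b - q) + β * (b - q) ^ 3) +
      ((q - a) + β * (q - a) ^ 3) with hW'
    have e₁ : ∀ z : ℝ × ℝ, Φ₁ (siteInsert 0 η z) = T * G' z.1 := by
      intro z
      simp only [hΦ₁, hG', siteInsert_apply_self, siteInsert_apply_of_ne h10, hb]
    have e₂ : ∀ z : ℝ × ℝ, Φ₂ (siteInsert 0 η z) = G z.1 * W' z.1 := by
      intro z
      simp only [hΦ₂, hG, hW', siteInsert_apply_self, siteInsert_apply_of_ne h10,
        siteInsert_apply_of_ne h12, ha, hb]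
      ring
    have hWq : ∀ q, (pinnedChain ω₂ lam β γ).U q + ((pinnedChain ω₂ lam β γ).V ((η (0 + 1)).1 - q) +
        (pinnedChain ω₂ lam β γ).V (q - (η (0 - 1)).1)) = W q := by
      intro q; simp only [hW, hb, ha]; norm_num
    rw [integral_chainSpecification_singleton_position (φ := fun q => T * G' q) hU hV hT 0 η hΦ₁m e₁,
      integral_chainSpecification_singleton_position (φ := fun q => G q * W' q) hU hV hT 0 η hΦ₂m e₂]
    simp_rw [hWq]
    congr 1
    -- `∫ T G' e^{-W/T} = ∫ G W' e^{-W/T}` on the line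
    have hw0 : ∀ q, 0 ≤ exp (-(W q) / T) := fun q => (exp_pos _).le
    have hwb : ∀ q, exp (-(W q) / T) ≤ exp (-(ω₂ / (2 * T) * q ^ 2)) := fun q =>
      pinnedChain_exp_neg_siteWeight_le (ω₂ := ω₂) (γ := γ) hl hβ hT a b q
    have hwc : Continuous fun q => exp (-(W q) / T) := by
      have : Continuous W := by simp only [hW]; fun_prop
      fun_prop
    have ha' : 0 < ω₂ / (2 * T) := by positivity
    set c : ℝ := 1 + |a| + |b| with hc
    have hc0 : 0 ≤ c := by positivity
    have hbounds := fun q => abs_shift_le a b q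
    have hGb : ∀ q, |G q| ≤ (c + β * c ^ 3) * (1 + |q|) ^ 3 := fun q =>
      abs_add_mul_cube_le hβ hc0 (hbounds q).2.1 (by linarith [abs_nonneg q])
    have hG'b : ∀ q, |G' q| ≤ (1 + 3 * β * c ^ 2) * (1 + |q|) ^ 2 := fun q => by
      simp only [hG', abs_neg]
      exact abs_one_add_mul_sq_le hβ (hbounds q).2.1 (by linarith [abs_nonneg q])
    have hW'b : ∀ q, |W' q| ≤ ((ω₂ * c + lam * c ^ 3) + (c + β * c ^ 3) + (c + β * c ^ 3)) *
        (1 + |q|) ^ 3 := by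
      intro q
      have ht : 1 ≤ 1 + |q| := by linarith [abs_nonneg q]
      have h1 := abs_lin_add_cube_le hω.le hl hc0 (hbounds q).2.2 ht
      have h2 := hGb q
      have h3 := abs_add_mul_cube_le hβ hc0 (hbounds q).1 ht
      calc |W' q| ≤ |ω₂ * q + lam * q ^ 3 - ((b - q) + β * (b - q) ^ 3)| + |(q - a) + β * (q - a) ^ 3| :=
            abs_add_le _ _
        _ ≤ (|ω₂ * q + lam * q ^ 3| + |(b - q) + β * (b - q) ^ 3|) + |(q - a) + β * (q - a) ^ 3| := by
            gcongr; exact abs_sub _ _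
        _ ≤ _ := by rw [hG] at h2; linarith
    have hGW'b : ∀ q, |G q * W' q| ≤ ((c + β * c ^ 3) *
        ((ω₂ * c + lam * c ^ 3) + (c + β * c ^ 3) + (c + β * c ^ 3))) * (1 + |q|) ^ 6 := by
      intro q
      rw [abs_mul]
      have h1 := hGb q; have h2 := hW'b q
      calc |G q| * |W' q| ≤ ((c + β * c ^ 3) * (1 + |q|) ^ 3) *
            (((ω₂ * c + lam * c ^ 3) + (c + β * c ^ 3) + (c + β * c ^ 3)) * (1 + |q|) ^ 3) :=
            mul_le_mul h1 h2 (abs_nonneg _) (by positivity)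
        _ = _ := by ring
    have hGc : Continuous G := by simp only [hG]; fun_prop
    have hG'c : Continuous G' := by simp only [hG']; fun_prop
    have hW'c : Continuous W' := by simp only [hW']; fun_prop
    have hi₀ : Integrable fun q => G q * exp (-(W q) / T) :=
      integrable_mul_of_abs_le_pow_of_le_gauss hGc hwc ha' hGb hw0 hwb
    have hi₁ : Integrable fun q => G' q * exp (-(W q) / T) :=
      integrable_mul_of_abs_le_pow_of_le_gauss hG'c hwc ha' hG'b hw0 hwb
    have hi₂ : Integrable fun q => G q * W' q * exp (-(W q) / T) :=
      integrable_mul_of_abs_le_pow_of_le_gauss (hGc.mul hW'c) hwc ha' hGW'b hw0 hwb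
    have hGd : ∀ q, HasDerivAt G (G' q) q := fun q => hasDerivAt_bondForce' β b q
    have hWd : ∀ q, HasDerivAt W (W' q) q := fun q =>
      pinnedChain_hasDerivAt_siteWeight (ω₂ := ω₂) (lam := lam) (β := β) (γ := γ) a b q
    have key := integral_deriv_mul_exp_eq hT.ne' hGd hWd hi₀ hi₁ hi₂
    calc ∫ q, T * G' q * exp (-(W q) / T) = T * ∫ q, G' q * exp (-(W q) / T) := by
          rw [← integral_const_mul]; refine integral_congr_ae (Eventually.of_forall fun q => ?_); ring
      _ = ∫ q, G q * W' q * exp (-(W q) / T) := key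
  -- DLR lift
  have h1 := integral_eq_integral_integral_chainSpecification hU.measurable hV.measurable hB2 hμ {0} hI₁
  have h2 := integral_eq_integral_integral_chainSpecification hU.measurable hV.measurable hB2 hμ {0} hI₂
  change ∫ σ, Φ₁ σ ∂μ = _ at h1
  change ∫ σ, Φ₂ σ ∂μ = _ at h2
  calc ∫ σ, Φ₁ σ ∂μ
      = ∫ η, ∫ σ, Φ₁ σ ∂((pinnedChain ω₂ lam β γ).chainSpecification T {0} η) ∂μ := h1
    _ = ∫ η, ∫ σ, Φ₂ σ ∂((pinnedChain ω₂ lam β γ).chainSpecification T {0} η) ∂μ := by simp_rw [hcond]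
    _ = ∫ σ, Φ₂ σ ∂μ := h2.symm

end PinnedChain

end Literature.MathematicalPhysics.KineticTheory.HeatConduction

end
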